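import Literature.NumberTheory.NumberFields.RayClassFieldAdicCharacterLocal
import HarnessLib

/-!
# The Frobenius order at `v` divides the degree of every local Weil element fixing `K(𝔪)`:
# `ord([⟨ϖ⟩_v, K]|_{K(𝔪)}) ∣ deg w` — the decomposition group of `v ∤ 𝔪` in `K(𝔪)/K` is generated by the Frobenius
# (Neukirch VI (5.6)/(7.3); de Shalit II.1.10: `Φ = K(𝔣)_𝔓` is unramified of degree `f = ord [𝔭] ∈ Cl(𝔣)`)

For `K` a number field, `𝔪 ≠ 0`, `v ∤ 𝔪`, any local Artin map `a` of `K_v` (`IsLocalArtinMap`) and a uniformiser `ϖ` of `K_v`: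
the element `Frob := [⟨ϖ⟩_v, K]|_{K(𝔪)} ∈ Gal(K(𝔪)/K)` (the Artin symbol of `𝔭_v`, tree `rayClassOfIdele_localUnits_eq_mk`)
controls the unramified directions of the local tower at `v`:

* `absGaloisRestrict_toAbsGalois_mem_ker_rayClassField_of_forall_smul_eq` — a local Weil element fixing `ι(K(𝔪))`
  (`ι : K̄ → K̄_v`) restricts into `Gal(K̄/K(𝔪))`;
* ★ `orderOf_frob_dvd_deg` — **if `res w` fixes `K(𝔪)` then `ord(Frob) ∣ deg w`**: `w = w₁·Φ^{−deg w}` with `a(Φ) = ϖ`,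
  `w₁ ∈ I_{K_v}`; local–global compatibility `ψ_{K(𝔪)}(⟨a w⟩_v)·(res w)|_{K(𝔪)} = 1` and `⟨unit⟩_v ∈ W_𝔪` give
  `Frob^{deg w} = 1`;
* ★ `orderOf_frob_dvd_deg_of_mem_fixingSubgroup` — the hypothesis `hdegE` of `RayClassFieldLocalTowerContainment.lean` for
  EVERY intermediate field `E ⊇ ι(K(𝔪))` of `K̄_v/K_v`, with `f := ord(Frob)` (`= ord [𝔭_v] ∈ Cl(𝔪)` = the residue degree of
  `K(𝔪)` at `v`, de Shalit's `f` with `𝔭^f = (α)`, `α ≡ 1 mod 𝔪`).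

Theorems only; no `sorry`.

## References
* [NeukirchANT1999] J. Neukirch, *Algebraic Number Theory* (1999), Ch. VI §5 Prop. (5.6), §7 Thm. (7.1), Cor. (7.3).
* [deShalit1987] E. de Shalit, *Iwasawa theory of elliptic curves with complex multiplication* (1987), II.1.10 (p. 39), II.4.3 (p. 57).
* [CasselsFrohlichANT1967] Cassels–Fröhlich (1967), Ch. VI §2 (Weil group), Ch. VII §5.
-/

noncomputable section

open NumberField IsDedekindDomain IsDedekindDomain.HeightOneSpectrum Field
open scoped nonZeroDivisors Classical

namespace Literature.NumberTheory.NumberFields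

open Literature.NumberTheory.GaloisRepresentations
open Literature.NumberTheory.GaloisRepresentations.ArtinLocalGlobal

variable {K : Type} [Field K] [NumberField K] {𝔪 : Ideal (𝓞 K)} {v : HeightOneSpectrum (𝓞 K)}
  {a : WeilGroup (v.adicCompletion K) →* (v.adicCompletion K)ˣ}

/-- `deg (Φ ^ k) = k · deg Φ` for `k ∈ ℤ`. [folklore] -/
private theorem deg_zpow' (Φ : WeilGroup (v.adicCompletion K)) (k : ℤ) :
    WeilGroup.deg (Φ ^ k) = k * WeilGroup.deg Φ := by
  have h := map_zpow (WeilGroup.degHom (v.adicCompletion K) IsFrobPow.mul_holds IsFrobPow.unique_holds) Φ k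
  rw [WeilGroup.degHom_apply, WeilGroup.degHom_apply, ← ofAdd_zsmul, smul_eq_mul] at h
  exact Multiplicative.ofAdd.injective h

omit [NumberField K] in
/-- `((τ|_L) x : K̄) = τ • x`. [folklore] -/
private theorem coe_absRestrictNormalHom_apply₈ (L : IntermediateField K (AlgebraicClosure K)) [Normal K L]
    (τ : absoluteGaloisGroup K) (x : L) :
    ((absRestrictNormalHom L τ x : L) : AlgebraicClosure K) = τ • (x : AlgebraicClosure K) :=
  AlgEquiv.restrictNormalHom_apply L _ x

/-- **A local Weil element fixing `ι(K(𝔪))` pointwise restricts into `Gal(K̄/K(𝔪))`** (`ι ∘ res w = w ∘ ι`, `ι` injective).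
[cite: NeukirchANT1999, Ch. VI §5 Prop. (5.6)] -/
theorem absGaloisRestrict_toAbsGalois_mem_ker_rayClassField_of_forall_smul_eq (w : WeilGroup (v.adicCompletion K))
    (hfix : ∀ x ∈ rayClassField K 𝔪, WeilGroup.toAbsGalois (v.adicCompletion K) w •
      absClosureEmbedding K (v.adicCompletion K) x = absClosureEmbedding K (v.adicCompletion K) x) :
    absGaloisRestrict K (v.adicCompletion K) (WeilGroup.toAbsGalois (v.adicCompletion K) w) ∈
      (absRestrictNormalHom (rayClassField K 𝔪)).ker := by
  rw [MonoidHom.mem_ker]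
  ext x
  rw [coe_absRestrictNormalHom_apply₈, AlgEquiv.one_apply]
  apply (absClosureEmbedding K (v.adicCompletion K)).injective
  have h := hfix x x.2
  rwa [← absGaloisRestrict_apply_smul] at h

open ValuativeRel in
/-- ★ **`ord([⟨ϖ⟩_v, K]|_{K(𝔪)}) ∣ deg w` whenever `res w` fixes `K(𝔪)`** (`𝔪 ≠ 0`, `v ∤ 𝔪`, `ϖ` a uniformiser of `K_v`,
`a` a local Artin map): the decomposition group of the unramified prime `v` in `K(𝔪)/K` is generated by the Frobenius
`[⟨ϖ⟩_v, K]|_{K(𝔪)}`, so an element of degree `d` acting trivially forces `Frob^d = 1`.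
[cite: NeukirchANT1999, Ch. VI §5 Prop. (5.6), §7 Cor. (7.3)] [cite: deShalit1987, II.1.10 (p. 39)] -/
theorem orderOf_frob_dvd_deg (h𝔪 : 𝔪 ≠ ⊥) (hv : ¬ 𝔪 ≤ v.asIdeal) (ha : IsLocalArtinMap (v.adicCompletion K) a)
    {ϖ : (v.adicCompletion K)ˣ} (hϖ : (valuation (v.adicCompletion K)).IsUniformizer ((ϖ : (v.adicCompletion K)ˣ) : v.adicCompletion K))
    (w : WeilGroup (v.adicCompletion K))
    (hw : absGaloisRestrict K (v.adicCompletion K) (WeilGroup.toAbsGalois (v.adicCompletion K) w) ∈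
      (absRestrictNormalHom (rayClassField K 𝔪)).ker) :
    (orderOf (abRestrict (rayClassField K 𝔪) (ideleArtinMap K (localUnits v ϖ))) : ℤ) ∣ WeilGroup.deg w := by
  haveI : NumberField (rayClassField K 𝔪) := NumberField.of_module_finite K _
  -- a Frobenius `Φ` with `a Φ = ϖ`, `deg Φ = -1`; `w₁ := w · Φ^{deg w}` is an inertia element
  obtain ⟨Φ, hΦdeg, hΦart⟩ := exists_deg_eq_neg_one_artin_eq ha (x := ϖ) hϖ
  set d := WeilGroup.deg w with hd
  have hdeg₁ : WeilGroup.deg (w * Φ ^ d) = 0 := by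
    rw [WeilGroup.deg_mul IsFrobPow.mul_holds IsFrobPow.unique_holds, deg_zpow', hΦdeg]; ring
  have hw₁ : w * Φ ^ d ∈ WeilGroup.inertia (v.adicCompletion K) :=
    (WeilGroup.deg_eq_zero_iff_mem_inertia IsFrobPow.mul_holds IsFrobPow.unique_holds).mp hdeg₁
  obtain ⟨u, hu⟩ := exists_unitsMap_eq_artin_of_mem_inertia ha hw₁
  -- local–global compatibility on `K(𝔪)` for `w` and for `w₁`
  have key := artinIdeleMap_localUnits_mul_absRestrictNormalHom v (rayClassField K 𝔪) ha w
  rw [MonoidHom.mem_ker] at hw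
  rw [hw, mul_one] at key
  -- `key : ψ(⟨a w⟩_v) = 1`; `a w = a(w₁) · (a Φ)^{-d} = u · ϖ^{-d}`
  have haw : a w = Units.map ((v.adicCompletionIntegers K).subtype : _ →* _) u * (ϖ ^ d)⁻¹ := by
    rw [hu, ← hΦart, ← map_zpow, ← map_inv, ← map_mul, mul_inv_cancel_right]
  have hunit : artinIdeleMap (rayClassField K 𝔪) artinReciprocity_character_holds
      (localUnits v (Units.map ((v.adicCompletionIntegers K).subtype : _ →* _) u)) = 1 := by
    rw [← abRestrict_ideleArtinMap, abRestrict_ideleArtinMap_rayClassField_eq_one_iff]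
    exact Subgroup.mem_sup_right (localUnits_integer_mem_rayUnitIdeles h𝔪 hv u)
  rw [haw, map_mul, map_mul, hunit, one_mul, map_inv, map_inv, map_zpow, map_zpow, inv_eq_one,
    ← abRestrict_ideleArtinMap] at key
  exact orderOf_dvd_iff_zpow_eq_one.mpr key

open ValuativeRel in
/-- ★ **The hypothesis `hdegE` of `RayClassFieldLocalTowerContainment` for every base `E ⊇ ι(K(𝔪))`**: with
`f := ord([⟨ϖ⟩_v, K]|_{K(𝔪)})` (the residue degree of `K(𝔪)` at `v`; for THE Artin map and `ϖ = π`, de Shalit's `f` with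
`𝔭^f = (α)`, `α ≡ 1 mod 𝔪`), every local Weil element fixing `E` has `f ∣ deg w`.
[cite: NeukirchANT1999, Ch. VI §7 Cor. (7.3)] [cite: deShalit1987, II.1.10 (p. 39), II.4.3 (p. 57)] -/
theorem orderOf_frob_dvd_deg_of_mem_fixingSubgroup (h𝔪 : 𝔪 ≠ ⊥) (hv : ¬ 𝔪 ≤ v.asIdeal)
    (ha : IsLocalArtinMap (v.adicCompletion K) a)
    {ϖ : (v.adicCompletion K)ˣ} (hϖ : (valuation (v.adicCompletion K)).IsUniformizer ((ϖ : (v.adicCompletion K)ˣ) : v.adicCompletion K))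
    {E : IntermediateField (v.adicCompletion K) (AlgebraicClosure (v.adicCompletion K))}
    (hE : ∀ x ∈ rayClassField K 𝔪, absClosureEmbedding K (v.adicCompletion K) x ∈ E)
    (w : WeilGroup (v.adicCompletion K)) (hwE : WeilGroup.toAbsGalois (v.adicCompletion K) w ∈ E.fixingSubgroup) :
    (orderOf (abRestrict (rayClassField K 𝔪) (ideleArtinMap K (localUnits v ϖ))) : ℤ) ∣ WeilGroup.deg w :=
  orderOf_frob_dvd_deg h𝔪 hv ha hϖ w
    (absGaloisRestrict_toAbsGalois_mem_ker_rayClassField_of_forall_smul_eq w fun x hx ↦ by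
      rw [Field.absoluteGaloisGroup.smul_def]
      exact (IntermediateField.mem_fixingSubgroup_iff _ _).mp hwE _ (hE x hx))

end Literature.NumberTheory.NumberFields

end
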